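import Summits.Ventures.PercRepro.LineCMinFace

/-!
# PercRepro — MIN-FACE: the facet form is exactly the bilinear form on ADJACENT pairs (typer-2, gen 5)

mine-1 (`proofs/MINE1-singlemerge.md` §10.2): «the step along `k` carries no information». This file
makes the relation between the two shapes of MIN-FACE exact:

* `SingleMergeMinFace` (the statement of record, `LineCMinFace.lean`) asks the cross-sum inequality
  `min(CS_B(c₀), CS_B(c₁)) ≤ 2 · X_B(c₀, c₁)` for every POINTWISE COMPARABLE pair of single-merge maps
  on one cube (arbitrary gaps);
* `SingleMergeMinFaceAdjacent` asks it only for ADJACENT pairs — `c₀ ρ = c₁ ρ ∨ IsSingleMerge (c₀ ρ) (c₁ ρ)`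
  at every `ρ` (`minFaceAdjacent_of_minFace`: the bilinear form implies it);
* **`minFaceFacet_iff_minFaceAdjacent`** — the adjacent form IS the facet form `SingleMergeMinFaceFacet`
  (stamp 60): a single-merge map on the `d`-cube is the same thing as an adjacent pair of single-merge
  maps on the `(d−1)`-cube, via the two facets one way (`facetBot_le_facetTop` is adjacency) and the GLUED
  map `glue c₀ c₁` on the cube of `Option S` the other way (`facetBot_glue`, `facetTop_glue`,
  `singleMergeMap_glue`), with `cubeSum` / `crossSum` invariant under the re-indexing
  `S ≃ {s : Option S // s ≠ none}` (`reindex`, `cubeSum_reindex`, `crossSum_reindex`).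

So: `SingleMergeMinFace ⇒ SingleMergeMinFaceAdjacent ⇔ SingleMergeMinFaceFacet ⇒ Lemma B (single merge) ⇒ C-005`
(`C005_of_minFaceAdjacent`), and the SAT runs on the facet form (j155486–92, j156097/8) and on the bilinear
form with adjacency imposed are, provably, about the same statement.
-/

namespace PercRepro

open Finset

/-! ### Transport of cube maps along an equivalence of coordinates -/

section Reindex

variable {S S' ι : Type*}

/-- Transport a cube map along an equivalence of coordinates: `reindex e c ρ = c (ρ ∘ e)`. -/
def reindex (e : S ≃ S') (c : Config S → ι) : Config S' → ι := fun ρ => c (ρ ∘ e)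

/-- The cube of `S'` against the cube of `S`, by precomposition with `e`. -/
def configCongr (e : S ≃ S') : Config S' ≃ Config S where
  toFun ρ := ρ ∘ e
  invFun ρ := ρ ∘ e.symm
  left_inv ρ := funext fun s' => congrArg ρ (e.apply_symm_apply s')
  right_inv ρ := funext fun s => congrArg ρ (e.symm_apply_apply s)

variable [Fintype S] [DecidableEq S] [Fintype S'] [DecidableEq S']

/-- The cross sum is invariant under re-indexing the coordinates. -/
theorem crossSum_reindex (e : S ≃ S') (K : ι → ι → ℝ) (c₀ c₁ : Config S → ι) :
    crossSum K (reindex e c₀) (reindex e c₁) = crossSum K c₀ c₁ := by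
  unfold crossSum reindex
  exact Fintype.sum_equiv (configCongr e) _ _ fun ρ => rfl

/-- The cube sum is invariant under re-indexing the coordinates. -/
theorem cubeSum_reindex (e : S ≃ S') (K : ι → ι → ℝ) (c : Config S → ι) :
    cubeSum K (reindex e c) = cubeSum K c :=
  crossSum_reindex e K c c

omit [Fintype S] [Fintype S'] in
/-- Re-indexing preserves single merge. -/
theorem singleMergeMap_reindex (e : S ≃ S') {c : Config S → Setoid (Fin 4)} (hc : SingleMergeMap c) :
    SingleMergeMap (reindex e c) := by
  intro ω s' hs'
  have hup : Function.update ω s' true ∘ e = Function.update (ω ∘ e) (e.symm s') true := by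
    funext s
    simp only [Function.comp_apply]
    by_cases hs : e s = s'
    · have hs2 : s = e.symm s' := by rw [← hs, Equiv.symm_apply_apply]
      rw [hs, Function.update_self, hs2, Function.update_self]
    · have hs2 : s ≠ e.symm s' := fun h => hs (by rw [h, Equiv.apply_symm_apply])
      rw [Function.update_of_ne hs, Function.update_of_ne hs2, Function.comp_apply]
  have h := hc (ω ∘ e) (e.symm s') (by rw [Function.comp_apply, Equiv.apply_symm_apply]; exact hs')
  unfold reindex
  rw [hup]
  exact h

end Reindex

/-! ### Gluing two cube maps along a new coordinate -/

section Glue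

variable {S ι : Type*}

/-- Glue two maps on the cube of `S` into one map on the cube of `Option S`; the new coordinate
`none` selects the map (`none ↦ false` reads `c₀`, `none ↦ true` reads `c₁`). -/
def glue (c₀ c₁ : Config S → ι) : Config (Option S) → ι :=
  fun σ => if σ none then c₁ (σ ∘ some) else c₀ (σ ∘ some)

/-- `S` as the coordinates of `Option S` other than `none`. -/
def someEquiv (S : Type*) : S ≃ {s : Option S // s ≠ none} where
  toFun t := ⟨some t, Option.some_ne_none t⟩
  invFun s := s.1.get (Option.ne_none_iff_isSome.mp s.2)
  left_inv _ := rfl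
  right_inv _ := Subtype.ext (Option.some_get _)

variable [DecidableEq S]

/-- The bottom facet at `none` of a glued map is the first map (re-indexed). -/
theorem facetBot_glue (c₀ c₁ : Config S → ι) :
    facetBot (glue c₀ c₁) none = reindex (someEquiv S) c₀ := by
  funext ρ
  unfold facetBot glue reindex
  rw [if_neg (by rw [extendAt_self]; exact Bool.false_ne_true)]
  exact congrArg c₀ (funext fun t => extendAt_of_ne none false ρ (Option.some_ne_none t))

/-- The top facet at `none` of a glued map is the second map (re-indexed). -/
theorem facetTop_glue (c₀ c₁ : Config S → ι) :
    facetTop (glue c₀ c₁) none = reindex (someEquiv S) c₁ := by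
  funext ρ
  unfold facetTop glue reindex
  rw [if_pos (extendAt_self none true ρ)]
  exact congrArg c₁ (funext fun t => extendAt_of_ne none true ρ (Option.some_ne_none t))

/-- Gluing two ADJACENT single-merge maps gives a single-merge map. -/
theorem singleMergeMap_glue {c₀ c₁ : Config S → Setoid (Fin 4)} (h₀ : SingleMergeMap c₀)
    (h₁ : SingleMergeMap c₁) (hadj : ∀ ρ, c₀ ρ = c₁ ρ ∨ IsSingleMerge (c₀ ρ) (c₁ ρ)) :
    SingleMergeMap (glue c₀ c₁) := by
  intro ω e he
  cases e with
  | none =>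
    have h1 : Function.update ω none true ∘ some = ω ∘ some := by
      funext t
      exact Function.update_of_ne (Option.some_ne_none t) _ _
    unfold glue
    rw [Function.update_self, if_neg (by rw [he]; exact Bool.false_ne_true), if_pos rfl, h1]
    exact hadj (ω ∘ some)
  | some t =>
    have h1 : Function.update ω (some t) true ∘ some = Function.update (ω ∘ some) t true := by
      funext s
      by_cases hs : s = t
      · subst hs
        rw [Function.comp_apply, Function.update_self, Function.update_self]
      · rw [Function.comp_apply, Function.update_of_ne (fun h => hs (Option.some_injective _ h)),
          Function.update_of_ne hs, Function.comp_apply]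
    have h2 : Function.update ω (some t) true none = ω none :=
      Function.update_of_ne (Option.some_ne_none t).symm _ _
    unfold glue
    rw [h2, h1]
    cases hω : ω none
    · simp only [Bool.false_eq_true, if_false]
      exact h₀ (ω ∘ some) t he
    · simp only [if_true]
      exact h₁ (ω ∘ some) t he

end Glue

/-! ### The three shapes of MIN-FACE -/

/-- **MIN-FACE, bilinear shape on ADJACENT pairs**: the cross-sum inequality for two single-merge maps
on one cube that differ by at most one merge at every configuration. -/
def SingleMergeMinFaceAdjacent : Prop :=
  ∀ {S : Type} [Fintype S] [DecidableEq S] (c₀ c₁ : Config S → Setoid (Fin 4)),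
    SingleMergeMap c₀ → SingleMergeMap c₁ → (∀ ρ, c₀ ρ = c₁ ρ ∨ IsSingleMerge (c₀ ρ) (c₁ ρ)) →
      min (cubeSumB c₀) (cubeSumB c₁) ≤ 2 * crossSumB c₀ c₁

/-- The bilinear form (arbitrary gaps) implies its adjacent case. -/
theorem minFaceAdjacent_of_minFace (h : SingleMergeMinFace) : SingleMergeMinFaceAdjacent := by
  intro S _ _ c₀ c₁ h₀ h₁ hadj
  refine h c₀ c₁ h₀ h₁ fun ρ => ?_
  rcases hadj ρ with heq | ⟨i, j, -, hij⟩
  · exact heq.le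
  · rw [hij]
    exact le_mergeBlocks _ i j

/-- **The facet form gives the adjacent form**: glue the two maps along a new coordinate and read the
facet inequality of the glued map at that coordinate. -/
theorem minFaceAdjacent_of_minFaceFacet (h : SingleMergeMinFaceFacet) : SingleMergeMinFaceAdjacent := by
  intro S _ _ c₀ c₁ h₀ h₁ hadj
  have key := h (glue c₀ c₁) (singleMergeMap_glue h₀ h₁ hadj) none
  rw [cubeSumB_eq_two_mul_crossSumB (glue c₀ c₁) none, facetBot_glue, facetTop_glue] at key
  unfold cubeSumB crossSumB at key ⊢
  rwa [cubeSum_reindex, cubeSum_reindex, crossSum_reindex] at key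

/-- **The adjacent form gives the facet form**: the two facets of a single-merge map are adjacent
single-merge maps, and `CS_B(c) = 2 · X_B(facetBot c k, facetTop c k)`. -/
theorem minFaceFacet_of_minFaceAdjacent (h : SingleMergeMinFaceAdjacent) : SingleMergeMinFaceFacet := by
  intro S _ _ c hc k
  rw [cubeSumB_eq_two_mul_crossSumB c k]
  refine h (facetBot c k) (facetTop c k) (facetBot_singleMergeMap hc k) (facetTop_singleMergeMap hc k)
    fun ρ => ?_
  unfold facetBot facetTop
  rw [← update_extendAt_false k ρ]
  exact hc (extendAt k false ρ) k (extendAt_self k false ρ)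

/-- **The facet form of MIN-FACE is exactly the bilinear form on adjacent pairs.** -/
theorem minFaceFacet_iff_minFaceAdjacent : SingleMergeMinFaceFacet ↔ SingleMergeMinFaceAdjacent :=
  ⟨minFaceAdjacent_of_minFaceFacet, minFaceFacet_of_minFaceAdjacent⟩

/-- The adjacent form of MIN-FACE closes C-005. -/
theorem C005_of_minFaceAdjacent (h : SingleMergeMinFaceAdjacent) : C005 :=
  C005_of_minFaceFacet (minFaceFacet_of_minFaceAdjacent h)

end PercRepro
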